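import Mathlib
import Literature.Analysis.FunctionSpaces.PoissonPointProcess
import Literature.Analysis.FunctionSpaces.PoissonMecke
import Literature.Analysis.FunctionSpaces.PoissonSuperpositionProofs
import Literature.Analysis.FunctionSpaces.PoissonPointProcessProofs
import Literature.Analysis.FunctionSpaces.PointConfigFactorialMeasure
import Summits.CriticalPhenomena.CardyFormulaZ2.Theorems.CardyFlipRussoSquareFromVoronoiHubSmallCellsPart1
import Summits.CriticalPhenomena.CardyFormulaZ2.Theorems.CardyFlipRussoSquareFromVoronoiHubSmallCellsPart4
import Summits.CriticalPhenomena.CardyFormulaZ2.Theorems.CardyFlipRussoSquareFromVoronoiHubNoDefectPart1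

/-!
# Stub `stub_noDefect` (S2 of K1), line `Sketch` of crux `SquareFromVoronoiHub` — Part 2:
# the five elementary bad events of a Poisson pair at a fixed scale

Crux `Summit.CriticalPhenomena.CardyFormulaZ2.Theses.CardyFlipRusso.SquareFromVoronoiHub`
(stmt-CriticalPhenomena-6434), line `Sketch` (card `voronoi-blocks-on-fixed-gs`), stub family K1,
registered stub `stub_noDefect`; registered sub-goal `stub_noDefect_part2`.  For two independent
Poisson processes `PB`, `PW` of Lebesgue intensity on `ℂ` (black and white nuclei) and the law
`Q = (PB ⊗ PW) ∘ (∪)⁻¹` of their union — Poisson of intensity `2 · Lebesgue` by the superposition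
theorem `IsPoissonPointProcess.superposition_holds` — this file bounds the probabilities of the
five elementary "bad events" whose union covers the defect event of the no-defect vocabulary
(`CardyFlipRussoSquareFromVoronoiHubFaithfulDefs`, `noDefect`), at a FIXED window `B(0, L)` and
fixed thresholds `(a, b, l)` (Bollobás–Riordan, *Percolation* (2006), Ch. 8 §8.3 flavour):

* (o) `measureReal_void_le`: a colour has no nucleus in a disc `B(z₀, t)` — `≤ 2e^{-πt²}` (void
  probability `IsPoissonPointProcess.measureReal_count_eq_zero`);
* (i) `measureReal_emptyDisc_le`: some point of `B(0, L)` is at distance `≥ a` from all nuclei of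
  `Q` — `≤ (4L/a + 5)² e^{-πa²/2}` (grid of mesh `a/2`, `exists_grid_near`, `card_grid_le`, void
  probabilities and a finite union bound);
* (ii) `measureReal_closePair_le`: an ordered pair of distinct nuclei of `Q` in
  `pairWindow L b` (first in `B(0, L)`, second within `b`) — `≤ 2πL² · 2πb²`, and
  (iii) `measureReal_pseudoEdge_le`: an ordered quadruple of distinct nuclei of `Q` in
  `quadWindow L a l` (Part 1) — `≤ 2πL² · (2π(5a)²)² · 50π a l`; both by the first-moment bound
  `measure_setOf_exists_tuples_le` of Part 1 and Tonelli (`pi_pairWindow_le`, `pi_quadWindow_le`);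
* (ii') `measure_not_disjoint_eq_zero`: the two colour classes share a nucleus — probability `0`
  (`IsPoissonPointProcess.ae_disjoint_carrier`);
* `measureReal_setOf_union_le`: events of the union transfer to `Q` (`Measure.le_map_apply`,
  valid for arbitrary sets, so no measurability of the bad events is needed downstream).

References: J. F. C. Kingman, *Poisson Processes* (1993), §2.1–2.2; G. Last, M. Penrose,
*Lectures on the Poisson Process* (2017), Thm 4.4; B. Bollobás, O. Riordan, *Percolation*
(2006), Ch. 8 §8.3.
-/

noncomputable section

namespace Summit.CriticalPhenomena.CardyFormulaZ2.Cruxes.SquareFromVoronoiHub.VoronoiBlocks.Faithful.NoDefect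

open scoped Topology ENNReal
open Set Filter MeasureTheory Metric
open Literature.Analysis.FunctionSpaces (PointConfig IsPoissonPointProcess)

/-! ### Mean numbers of windowed close pairs and short pseudo-edges -/

/-- The windowed close-pair set: first nucleus in `B(0, L)`, second within `b` of it. [folklore] -/
def pairWindow (L b : ℝ) : Set (Fin 2 → ℂ) := {x | x 0 ∈ ball (0 : ℂ) L ∧ x 1 ∈ ball (x 0) b}

/-- `pairWindow L b` is measurable (open). [folklore] -/
theorem measurableSet_pairWindow (L b : ℝ) : MeasurableSet (pairWindow L b) := by
  have hc : ∀ i : Fin 2, Continuous fun x : Fin 2 → ℂ => x i := fun i => continuous_apply i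
  refine IsOpen.measurableSet ?_
  simp only [pairWindow, setOf_and, mem_ball]
  exact (isOpen_ball.preimage (hc 0)).inter (isOpen_lt ((hc 1).dist (hc 0)) continuous_const)

/-- **Mean number of windowed close pairs**: `(2 vol)^{⊗2} (pairWindow L b) ≤ 2π L² · 2π b²`.
[folklore] -/
theorem pi_pairWindow_le {L b : ℝ} (hL : 0 ≤ L) (hb : 0 ≤ b) :
    Measure.pi (fun _ : Fin 2 => (volume + volume : Measure ℂ)) (pairWindow L b) ≤
      ENNReal.ofReal (2 * Real.pi * L ^ 2) * ENNReal.ofReal (2 * Real.pi * b ^ 2) := by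
  have hm := measurableSet_pairWindow L b
  have hI : ∀ (x : ℂ) (r : ℝ), Measurable fun y : ℂ => (ball x r).indicator (1 : ℂ → ℝ≥0∞) y :=
    fun x r => measurable_one.indicator measurableSet_ball
  rw [← lintegral_indicator_one hm, lintegral_pi_fin_two _ (measurable_one.indicator hm)]
  have hpt : ∀ x₀ x₁ : ℂ, (pairWindow L b).indicator (1 : (Fin 2 → ℂ) → ℝ≥0∞) ![x₀, x₁] ≤
      (ball (0 : ℂ) L).indicator (1 : ℂ → ℝ≥0∞) x₀ * (ball x₀ b).indicator (1 : ℂ → ℝ≥0∞) x₁ := by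
    intro x₀ x₁
    by_cases hx : (![x₀, x₁] : Fin 2 → ℂ) ∈ pairWindow L b
    · have h0 : x₀ ∈ ball (0 : ℂ) L := by simpa [pairWindow] using hx.1
      have h1 : x₁ ∈ ball x₀ b := by simpa [pairWindow] using hx.2
      simp only [indicator_of_mem hx, indicator_of_mem h0, indicator_of_mem h1, Pi.one_apply,
        mul_one, le_refl]
    · simp only [indicator_of_notMem hx]
      exact bot_le
  calc ∫⁻ x₀, ∫⁻ x₁, (pairWindow L b).indicator (1 : (Fin 2 → ℂ) → ℝ≥0∞) ![x₀, x₁]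
        ∂(volume + volume) ∂(volume + volume)
      ≤ ∫⁻ x₀, ∫⁻ x₁, (ball (0 : ℂ) L).indicator (1 : ℂ → ℝ≥0∞) x₀ *
          (ball x₀ b).indicator (1 : ℂ → ℝ≥0∞) x₁ ∂(volume + volume) ∂(volume + volume) :=
        lintegral_mono fun x₀ => lintegral_mono fun x₁ => hpt x₀ x₁
    _ = ∫⁻ x₀, (ball (0 : ℂ) L).indicator (1 : ℂ → ℝ≥0∞) x₀ * ENNReal.ofReal (2 * Real.pi * b ^ 2)
          ∂(volume + volume) := by
        refine lintegral_congr fun x₀ => ?_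
        rw [lintegral_const_mul _ (hI x₀ b), lintegral_indicator_one measurableSet_ball,
          volume_add_volume_ball x₀ hb]
    _ = ENNReal.ofReal (2 * Real.pi * L ^ 2) * ENNReal.ofReal (2 * Real.pi * b ^ 2) := by
        rw [lintegral_mul_const _ (hI 0 L), lintegral_indicator_one measurableSet_ball,
          volume_add_volume_ball 0 hL]

/-- **Mean number of windowed short pseudo-edges**:
`(2 vol)^{⊗4} (quadWindow L a l) ≤ 2πL² · (2π(5a)²)² · 50π a l`. [folklore] -/
theorem pi_quadWindow_le {L a l : ℝ} (hL : 0 ≤ L) (ha : 0 < a) (hl : 0 < l) (hla : l ≤ a) :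
    Measure.pi (fun _ : Fin 4 => (volume + volume : Measure ℂ)) (quadWindow L a l) ≤
      ENNReal.ofReal (2 * Real.pi * L ^ 2) * ENNReal.ofReal (2 * Real.pi * (5 * a) ^ 2) *
        (ENNReal.ofReal (2 * Real.pi * (5 * a) ^ 2) * ENNReal.ofReal (50 * Real.pi * a * l)) := by
  have hm := measurableSet_quadWindow L a l
  have h5a : (0 : ℝ) ≤ 5 * a := by positivity
  have hI : ∀ (x : ℂ) (r : ℝ), Measurable fun y : ℂ => (ball x r).indicator (1 : ℂ → ℝ≥0∞) y :=
    fun x r => measurable_one.indicator measurableSet_ball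
  rw [← lintegral_indicator_one hm, lintegral_pi_fin_four _ (measurable_one.indicator hm)]
  calc ∫⁻ x₀, ∫⁻ x₁, ∫⁻ x₂, ∫⁻ x₃, (quadWindow L a l).indicator (1 : (Fin 4 → ℂ) → ℝ≥0∞)
        ![x₀, x₁, x₂, x₃] ∂(volume + volume) ∂(volume + volume) ∂(volume + volume)
        ∂(volume + volume)
      ≤ ∫⁻ x₀, ∫⁻ x₁, ∫⁻ x₂, ((ball (0 : ℂ) L).indicator (1 : ℂ → ℝ≥0∞) x₀ *
          (ball x₀ (5 * a)).indicator (1 : ℂ → ℝ≥0∞) x₁) *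
          ((ball x₀ (5 * a)).indicator (1 : ℂ → ℝ≥0∞) x₂ * ENNReal.ofReal (50 * Real.pi * a * l))
          ∂(volume + volume) ∂(volume + volume) ∂(volume + volume) :=
        lintegral_mono fun x₀ => lintegral_mono fun x₁ => lintegral_mono fun x₂ =>
          lintegral_quadWindow_section_le ha hl hla x₀ x₁ x₂
    _ = ∫⁻ x₀, ∫⁻ x₁, ((ball (0 : ℂ) L).indicator (1 : ℂ → ℝ≥0∞) x₀ *
          (ball x₀ (5 * a)).indicator (1 : ℂ → ℝ≥0∞) x₁) *
          (ENNReal.ofReal (2 * Real.pi * (5 * a) ^ 2) * ENNReal.ofReal (50 * Real.pi * a * l))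
          ∂(volume + volume) ∂(volume + volume) := by
        refine lintegral_congr fun x₀ => lintegral_congr fun x₁ => ?_
        rw [lintegral_const_mul _ ((hI x₀ _).mul_const _), lintegral_mul_const _ (hI x₀ _),
          lintegral_indicator_one measurableSet_ball, volume_add_volume_ball x₀ h5a]
    _ = ∫⁻ x₀, ((ball (0 : ℂ) L).indicator (1 : ℂ → ℝ≥0∞) x₀ *
          ENNReal.ofReal (2 * Real.pi * (5 * a) ^ 2)) *
          (ENNReal.ofReal (2 * Real.pi * (5 * a) ^ 2) * ENNReal.ofReal (50 * Real.pi * a * l))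
          ∂(volume + volume) := by
        refine lintegral_congr fun x₀ => ?_
        rw [lintegral_mul_const _ ((hI x₀ _).const_mul _), lintegral_const_mul _ (hI x₀ _),
          lintegral_indicator_one measurableSet_ball, volume_add_volume_ball x₀ h5a]
    _ = _ := by
        rw [lintegral_mul_const _ ((hI 0 L).mul_const _), lintegral_mul_const _ (hI 0 L),
          lintegral_indicator_one measurableSet_ball, volume_add_volume_ball 0 hL]


/-! ### Poisson estimates for the superposed process `Q` (intensity `2 · Lebesgue`) -/

section Superposed

variable {Q : Measure (PointConfig ℂ)}

/-- **A square grid of mesh `a/2` covers the disc `B(0, L)` within distance `a/2`**, using the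
`(2K+1)²` nodes with integer coordinates in `[-K, K]`, `K = ⌈2L/a⌉ + 1`. [folklore] -/
theorem exists_grid_near {L a : ℝ} (ha : 0 < a) {z : ℂ} (hz : z ∈ ball (0 : ℂ) L) :
    ∃ ij ∈ Finset.Icc (-((⌈2 * L / a⌉₊ + 1 : ℕ) : ℤ)) (⌈2 * L / a⌉₊ + 1 : ℕ) ×ˢ
        Finset.Icc (-((⌈2 * L / a⌉₊ + 1 : ℕ) : ℤ)) (⌈2 * L / a⌉₊ + 1 : ℕ),
      dist z (⟨a / 2 * (ij.1 : ℝ), a / 2 * (ij.2 : ℝ)⟩ : ℂ) ≤ a / 2 := by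
  have ha2 : 0 < a / 2 := by positivity
  set i : ℤ := round (z.re / (a / 2)) with hi
  set j : ℤ := round (z.im / (a / 2)) with hj
  have hzL : ‖z‖ < L := by simpa using hz
  have hre : |z.re - a / 2 * i| ≤ a / 4 := by
    have h := abs_sub_round (z.re / (a / 2))
    rw [← hi] at h
    have e : z.re - a / 2 * i = (a / 2) * (z.re / (a / 2) - i) := by field_simp
    rw [e, abs_mul, abs_of_pos ha2]
    nlinarith
  have him : |z.im - a / 2 * j| ≤ a / 4 := by
    have h := abs_sub_round (z.im / (a / 2))
    rw [← hj] at h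
    have e : z.im - a / 2 * j = (a / 2) * (z.im / (a / 2) - j) := by field_simp
    rw [e, abs_mul, abs_of_pos ha2]
    nlinarith
  have hK : ∀ {x : ℝ} {k : ℤ}, |x| < L → k = round (x / (a / 2)) →
      |(k : ℝ)| < ((⌈2 * L / a⌉₊ + 1 : ℕ) : ℝ) := by
    intro x k hx hk
    have h := abs_sub_round (x / (a / 2))
    rw [← hk] at h
    have h1 : |(k : ℝ)| ≤ |x / (a / 2)| + 1 / 2 := by
      have := abs_sub_abs_le_abs_sub (k : ℝ) (x / (a / 2))
      rw [abs_sub_comm] at this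
      linarith
    have h2 : |x / (a / 2)| < 2 * L / a := by
      rw [abs_div, abs_of_pos ha2, div_lt_iff₀ ha2]
      have e : 2 * L / a * (a / 2) = L := by field_simp
      linarith
    have h3 : 2 * L / a ≤ ⌈2 * L / a⌉₊ := Nat.le_ceil _
    push_cast
    linarith
  refine ⟨(i, j), ?_, ?_⟩
  · rw [Finset.mem_product]
    exact ⟨SmallCells.int_mem_Icc_of_abs_lt (hK ((Complex.abs_re_le_norm z).trans_lt hzL) hi),
      SmallCells.int_mem_Icc_of_abs_lt (hK ((Complex.abs_im_le_norm z).trans_lt hzL) hj)⟩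
  · rw [dist_eq_norm]
    refine (Complex.norm_le_abs_re_add_abs_im _).trans ?_
    simp only [Complex.sub_re, Complex.sub_im]
    linarith

/-- The bounding box of the grid has `(2K+1)²` nodes, and `2K + 1 ≤ 4L/a + 5`. [folklore] -/
theorem card_grid_le {L a : ℝ} (hL : 0 ≤ L) (ha : 0 < a) :
    ((Finset.Icc (-((⌈2 * L / a⌉₊ + 1 : ℕ) : ℤ)) (⌈2 * L / a⌉₊ + 1 : ℕ) ×ˢ
        Finset.Icc (-((⌈2 * L / a⌉₊ + 1 : ℕ) : ℤ)) (⌈2 * L / a⌉₊ + 1 : ℕ)).card : ℝ) ≤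
      (4 * L / a + 5) ^ 2 := by
  set K : ℕ := ⌈2 * L / a⌉₊ + 1 with hK
  have h : (Finset.Icc (-(K : ℤ)) K).card = 2 * K + 1 := by
    rw [Int.card_Icc]; omega
  rw [Finset.card_product, h]
  have hK2 : (K : ℝ) ≤ 2 * L / a + 2 := by
    rw [hK]; push_cast
    linarith [Nat.ceil_lt_add_one (by positivity : (0 : ℝ) ≤ 2 * L / a)]
  have h3 : (2 * (K : ℝ) + 1) ≤ 4 * L / a + 5 := by
    have e : 4 * L / a = 2 * (2 * L / a) := by ring
    rw [e]; linarith
  have h0 : (0 : ℝ) ≤ 2 * K + 1 := by positivity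
  push_cast
  calc (2 * (K : ℝ) + 1) * (2 * K + 1) = (2 * K + 1) ^ 2 := by ring
    _ ≤ (4 * L / a + 5) ^ 2 := pow_le_pow_left₀ h0 h3 2

/-- **(i) No empty disc.**  The probability that some point of `B(0, L)` has no nucleus of the
superposed process within distance `a` is at most `(4L/a + 5)² e^{-π a²/2}`: cover by the grid
discs of radius `a/2`, each void with probability `e^{-2 · π a²/4}` (void probability
`IsPoissonPointProcess.measureReal_count_eq_zero`), and a union bound. [folklore] -/
theorem measureReal_emptyDisc_le (hQ : IsPoissonPointProcess (volume + volume : Measure ℂ) Q)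
    {L a : ℝ} (hL : 0 ≤ L) (ha : 0 < a) :
    Q.real {u | ∃ z ∈ ball (0 : ℂ) L, ∀ p ∈ u, a ≤ dist z p} ≤
      (4 * L / a + 5) ^ 2 * Real.exp (-(Real.pi * a ^ 2 / 2)) := by
  haveI := hQ.isProbabilityMeasure
  set K : ℕ := ⌈2 * L / a⌉₊ + 1 with hK
  set box : Finset (ℤ × ℤ) := Finset.Icc (-(K : ℤ)) K ×ˢ Finset.Icc (-(K : ℤ)) K with hbox
  set g : ℤ × ℤ → ℂ := fun ij => ⟨a / 2 * (ij.1 : ℝ), a / 2 * (ij.2 : ℝ)⟩ with hg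
  have ha2 : 0 ≤ a / 2 := by positivity
  have hsub : {u : PointConfig ℂ | ∃ z ∈ ball (0 : ℂ) L, ∀ p ∈ u, a ≤ dist z p} ⊆
      ⋃ ij ∈ box, {u | u.count (ball (g ij) (a / 2)) = 0} := by
    rintro u ⟨z, hz, hfar⟩
    obtain ⟨ij, hij, hdist⟩ := exists_grid_near ha hz
    refine mem_iUnion₂.2 ⟨ij, hij, (SmallCells.count_eq_zero_iff u _).2 fun p hp hpb => ?_⟩
    rw [mem_ball] at hpb
    have := dist_triangle z (g ij) p
    rw [dist_comm (g ij) p] at this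
    linarith [hfar p hp]
  have hvol : ∀ ij, (volume + volume : Measure ℂ) (ball (g ij) (a / 2)) =
      ENNReal.ofReal (2 * Real.pi * (a / 2) ^ 2) := fun ij => volume_add_volume_ball _ ha2
  calc Q.real {u | ∃ z ∈ ball (0 : ℂ) L, ∀ p ∈ u, a ≤ dist z p}
      ≤ Q.real (⋃ ij ∈ box, {u | u.count (ball (g ij) (a / 2)) = 0}) :=
        measureReal_mono hsub (measure_ne_top _ _)
    _ ≤ ∑ ij ∈ box, Q.real {u | u.count (ball (g ij) (a / 2)) = 0} :=
        measureReal_biUnion_finset_le box _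
    _ = ∑ ij ∈ box, Real.exp (-(Real.pi * a ^ 2 / 2)) := by
        refine Finset.sum_congr rfl fun ij _ => ?_
        rw [hQ.measureReal_count_eq_zero measurableSet_ball
          (by rw [hvol]; exact ENNReal.ofReal_ne_top), hvol,
          ENNReal.toReal_ofReal (by positivity)]
        ring_nf
    _ = (box.card : ℝ) * Real.exp (-(Real.pi * a ^ 2 / 2)) := by
        rw [Finset.sum_const, nsmul_eq_mul]
    _ ≤ (4 * L / a + 5) ^ 2 * Real.exp (-(Real.pi * a ^ 2 / 2)) :=
        mul_le_mul_of_nonneg_right (card_grid_le hL ha) (Real.exp_nonneg _)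

/-- **(ii) No close pair.**  The probability that the superposed process has an (ordered) pair of
distinct nuclei in `pairWindow L b` is at most its mean `2πL² · 2πb²` (first moment,
`measure_setOf_exists_tuples_le` + `pi_pairWindow_le`). [folklore] -/
theorem measureReal_closePair_le (hQ : IsPoissonPointProcess (volume + volume : Measure ℂ) Q)
    {L b : ℝ} (hL : 0 ≤ L) (hb : 0 ≤ b) :
    Q.real {u | ∃ x ∈ PointConfig.tuples 2 u, x ∈ pairWindow L b} ≤
      2 * Real.pi * L ^ 2 * (2 * Real.pi * b ^ 2) := by
  refine ENNReal.toReal_le_of_le_ofReal (by positivity) ?_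
  refine (measure_setOf_exists_tuples_le hQ (measurableSet_pairWindow L b)).trans ?_
  rw [ENNReal.ofReal_mul (by positivity)]
  exact pi_pairWindow_le hL hb

/-- **(iii) No short pseudo-edge.**  The probability that the superposed process has an (ordered)
quadruple of distinct nuclei in `quadWindow L a l` is at most its mean
`2πL² · (2π(5a)²)² · 50π a l`. [folklore] -/
theorem measureReal_pseudoEdge_le (hQ : IsPoissonPointProcess (volume + volume : Measure ℂ) Q)
    {L a l : ℝ} (hL : 0 ≤ L) (ha : 0 < a) (hl : 0 < l) (hla : l ≤ a) :
    Q.real {u | ∃ x ∈ PointConfig.tuples 4 u, x ∈ quadWindow L a l} ≤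
      2 * Real.pi * L ^ 2 * (2 * Real.pi * (5 * a) ^ 2) *
        (2 * Real.pi * (5 * a) ^ 2 * (50 * Real.pi * a * l)) := by
  refine ENNReal.toReal_le_of_le_ofReal (by positivity) ?_
  refine (measure_setOf_exists_tuples_le hQ (measurableSet_quadWindow L a l)).trans ?_
  have h := pi_quadWindow_le hL ha hl hla
  rw [← ENNReal.ofReal_mul (by positivity), ← ENNReal.ofReal_mul (by positivity),
    ← ENNReal.ofReal_mul (by positivity)] at h
  exact h

end Superposed

/-! ### Estimates for the pair of independent processes -/

section Pair

variable {PB PW : Measure (PointConfig ℂ)}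

/-- **(o) Both colours occur**: the probability that one of the two colours has no nucleus in the
disc `B(z₀, t)` is at most `2 e^{-π t²}` (void probabilities). [folklore] -/
theorem measureReal_void_le (hB : IsPoissonPointProcess (volume : Measure ℂ) PB)
    (hW : IsPoissonPointProcess (volume : Measure ℂ) PW) (z₀ : ℂ) {t : ℝ} (ht : 0 ≤ t) :
    (PB.prod PW).real ({c | c.1.count (ball z₀ t) = 0} ∪ {c | c.2.count (ball z₀ t) = 0}) ≤
      2 * Real.exp (-(Real.pi * t ^ 2)) := by
  haveI := hB.isProbabilityMeasure
  haveI := hW.isProbabilityMeasure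
  have h1 : {c : PointConfig ℂ × PointConfig ℂ | c.1.count (ball z₀ t) = 0} =
      {d : PointConfig ℂ | d.count (ball z₀ t) = 0} ×ˢ univ := by
    ext c; simp
  have h2 : {c : PointConfig ℂ × PointConfig ℂ | c.2.count (ball z₀ t) = 0} =
      (univ : Set (PointConfig ℂ)) ×ˢ {d : PointConfig ℂ | d.count (ball z₀ t) = 0} := by
    ext c; simp
  have hv : (volume (ball z₀ t)).toReal = Real.pi * t ^ 2 := by
    rw [← measureReal_def, SmallCells.volume_real_ball z₀ ht]
  refine (measureReal_union_le _ _).trans ?_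
  rw [h1, h2, measureReal_prod_prod, measureReal_prod_prod, probReal_univ, probReal_univ,
    hB.measureReal_count_eq_zero measurableSet_ball (SmallCells.volume_ball_ne_top _ _),
    hW.measureReal_count_eq_zero measurableSet_ball (SmallCells.volume_ball_ne_top _ _), hv]
  linarith

/-- **(ii') No shared nucleus**: two independent Poisson processes of Lebesgue intensity almost
surely have disjoint sets of nuclei (`IsPoissonPointProcess.ae_disjoint_carrier`). [folklore] -/
theorem measure_not_disjoint_eq_zero (hB : IsPoissonPointProcess (volume : Measure ℂ) PB)
    (hW : IsPoissonPointProcess (volume : Measure ℂ) PW) :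
    (PB.prod PW) {c | ¬ Disjoint (c.1 : Set ℂ) (c.2 : Set ℂ)} = 0 :=
  ae_iff.1 (IsPoissonPointProcess.ae_disjoint_carrier hB hW)

/-- **Superposition transfer**: an event of the union `c.1 ∪ c.2` is at most as likely as the same
event under the law `Q` of the union, which is Poisson of intensity `2 · Lebesgue`
(`superposition_holds`; `Measure.le_map_apply`, valid for every set). [folklore] -/
theorem measureReal_setOf_union_le (hB : IsPoissonPointProcess (volume : Measure ℂ) PB)
    (hW : IsPoissonPointProcess (volume : Measure ℂ) PW) (F : Set (PointConfig ℂ)) :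
    (PB.prod PW).real {c | c.1 ∪ c.2 ∈ F} ≤
      ((PB.prod PW).map fun p : PointConfig ℂ × PointConfig ℂ => p.1 ∪ p.2).real F := by
  have hm : Measurable fun p : PointConfig ℂ × PointConfig ℂ => p.1 ∪ p.2 :=
    PointConfig.measurable_union_holds
  haveI := (IsPoissonPointProcess.superposition_holds hB hW).isProbabilityMeasure
  exact ENNReal.toReal_mono (measure_ne_top _ _) (Measure.le_map_apply hm.aemeasurable F)

end Pair

/-! ### Registered sub-goal of the stub (Part 2) -/

/-- **Part 2 of stub `stub_noDefect`, registered sub-goal** (`--supports stmt-CriticalPhenomena-6434`):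
the short-pseudo-edge bound (iii) `measureReal_pseudoEdge_le` as a closed statement. [folklore] -/
theorem stub_noDefect_part2 : ∀ {Q : Measure (PointConfig ℂ)},
    IsPoissonPointProcess (volume + volume : Measure ℂ) Q → ∀ {L a l : ℝ}, 0 ≤ L → 0 < a →
    0 < l → l ≤ a → Q.real {u | ∃ x ∈ PointConfig.tuples 4 u, x ∈ quadWindow L a l} ≤
      2 * Real.pi * L ^ 2 * (2 * Real.pi * (5 * a) ^ 2) *
        (2 * Real.pi * (5 * a) ^ 2 * (50 * Real.pi * a * l)) :=
  fun hQ _ _ _ hL ha hl hla => measureReal_pseudoEdge_le hQ hL ha hl hla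

end Summit.CriticalPhenomena.CardyFormulaZ2.Cruxes.SquareFromVoronoiHub.VoronoiBlocks.Faithful.NoDefect

end
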